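import Summits.Langlands.Langlands.Theses.TriangulineChamber

/-!
# Route TriangulineChamber — Assembly (item stmt-Langlands-8577)

The typed assembly item of route `TriangulineChamber` for the Langlands summit:

`LiftB2CrysUnramifiedP → LiftB2CrysRamifiedP → LiftB2CrysGeneric`.

Pure logic at the typed layer: the target slice `LiftB2CrysGeneric` (automorphy lifting for GL₂
over a totally real `F`, `7 ≤ p`, ANY ramification of `p` in `F`) is the conjunction of its two
sub-slices, which differ from it only by the extra hypothesis `¬ (p : ℤ) ∣ discr F`
(`LiftB2CrysUnramifiedP`) resp. `(p : ℤ) ∣ discr F` (`LiftB2CrysRamifiedP`).  After unfolding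
`Assembly` and introducing `F`, `p`, `7 ≤ p`, the goal is closed by `by_cases` on
`(p : ℤ) ∣ NumberField.discr F` — the same case split the route's deciding theorem
`Summit.Langlands.Langlands.Theses.TriangulineChamber.closes` performs inline (rev 9).  The item
carries no mathematics of its own; the mathematical glue IRR'' ∧ OrdinaryComponent ∧ TypeSeeds ⇒
slices is the informal support BHSChamberAssembly (stmt-Langlands-8610).
-/

set_option linter.dupNamespace false -- project-wide option (lakefile weak.linter.dupNamespace); `Summit.Langlands.Langlands` is the mandated namespace

namespace Summit.Langlands.Langlands.Theorems.TriangulineChamber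

open Summit.Langlands.Langlands.Theses.TriangulineChamber

/-- **Assembly of route TriangulineChamber** (item stmt-Langlands-8577):
`LiftB2CrysUnramifiedP → LiftB2CrysRamifiedP → LiftB2CrysGeneric`.  Given the unramified-`p` slice
`hU` and the ramified-`p` slice `hR`, for a totally real number field `F` and a prime `p ≥ 7` the
required reciprocity datum with its pins and lifting property is supplied by `hR F p hp h` when
`h : (p : ℤ) ∣ discr F` and by `hU F p hp h` otherwise (classical `by_cases`). -/
theorem Assembly_proof : Summit.Langlands.Langlands.Theses.TriangulineChamber.Assembly := by
  unfold Summit.Langlands.Langlands.Theses.TriangulineChamber.Assembly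
  intro hU hR F _ _ _ p _ hp
  by_cases h : ((p : ℤ) ∣ NumberField.discr F)
  · exact hR F p hp h
  · exact hU F p hp h

end Summit.Langlands.Langlands.Theorems.TriangulineChamber
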